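import Summits.Ventures.GridStability.Bench.SharpConnectivityPath300CertData
import Summits.Ventures.GridStability.Bench.GroundedLaplacianPath300Cert
import HarnessLib

/-!
# SharpConnectivityPath300Cert — T-L2b instance: the DECIDES (columns in range, symmetry, clique-sum sweep, block LDLᵀ) and the certified
connectivity constant for the data of `SharpConnectivityPath300CertData.lean` (see its header for the graph, λ, sizes and heights). [folklore]
-/

namespace Summit.Ventures.GridStability.Bench.SharpConnectivityPath300Cert

open Literature.Computation.Certificates Literature.Computation.Certificates.PSD
open Literature.MathematicalPhysics.PowerSystems Summit.Ventures.GridStability.Lyapunov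

/-! The weight matrix `W` of this module is the SAME literal as `GroundedLaplacianPath300Cert.W` (the PATH-300 feeder of
CS27), so `colsBelow` / symmetry are REUSED from that module (`GroundedLaplacianPath300Cert.cols` / `.symm`, definitionally the
same propositions) instead of being decided again. -/

/-- The rank-one NEGATIVE term split off at the single negative pivot (node 150): `p`. [folklore] -/
def p : ℚ := ((-13284368607 : ℚ) / 549755813888)

/-- The sparse rank-one column `u = ℓ_a` (support = the clique of the negative pivot). [folklore] -/
def us : SRow ℚ := [(150, (1 : ℚ)), (151, ((549755813888 : ℚ) / 13284368607))]

/-- `u` has in-range columns. [folklore] -/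
theorem usCols : (us.all fun q => decide (q.1 < 300)) = true := by decide +kernel

/-- `Σ uᵢ ≠ 0`. [folklore] -/
theorem usum : srowTotal us ≠ 0 := by decide +kernel

/-- The SHARP certificate's two kernel checks in ONE decide: the clique-sum identity `L − λI − p·uuᵀ = Σ_c P_cᵀ S_c P_c` for
the rows COMPUTED by `sharpSMat`, and every clique block PSD by in-kernel exact `LDLᵀ`. [folklore] -/
theorem sharpCert :
    cliqueSweepS 300 0 300 (sharpSMat 300 W lam p us) blocks = true ∧ ldlAll blocks = true := by
  decide +kernel

/-- **SHARP CERTIFIED CONNECTIVITY CONSTANT** `λ = 137/1048576 = 0.98·λ₂` (no grounding loss; CS27's grounded-at-the-end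
constant was `17/524288 = 0.25·λ₂`): `∀ z, λ·‖Hz‖₂² ≤ 300·½ΣΣ wᵢⱼ(zᵢ − zⱼ)²` for the rational PATH-300 weights. [folklore] -/
theorem sharp_connectivity_certificate :
    ∀ z : Fin 300 → ℝ, (((137 : ℚ) / 1048576 : ℚ) : ℝ) * pairNormSq z
      ≤ ((299 + 1 : ℕ) : ℝ) * (1 / 2 * ∑ i, ∑ j, ((matrixOfSparseRows 300 300 W i j : ℚ) : ℝ) * (z i - z j) ^ 2) :=
  sharp_connectivity_certificate_of_smat (d := 9) W (by norm_num) GroundedLaplacianPath300Cert.cols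
    GroundedLaplacianPath300Cert.symm lam (by norm_num [lam]) p us usCols usum blocks sharpCert.1 sharpCert.2

end Summit.Ventures.GridStability.Bench.SharpConnectivityPath300Cert
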